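import Summits.HodgeConjecture.HodgeConjecture.Theorems.MarkmanPartnerTransportPicardThreeK3SquaresOneCycleAlgebra

/-!
# Route MarkmanPartnerTransport · crux `PicardThreeK3Squares` (stmt-HodgeConjecture-19652) —
# ONE CYCLE SUFFICES, part 5: the DEGREE form — an endomorphism whose `(2,0)`-eigenvalue has degree `k`
# with `22 - ρ(S) ≠ k·j·m` (`j ≥ 2`, `m ≥ 3`) generates `End_Hdg(T(S))`

Sequel to `…OneCycle` (prime form: `d · m + ρ = 22, m ≥ 3 ⟹ d prime`, which is silent at
`ρ(S) ∈ {2, 4, 6, 10}`). Here the arithmetic input is the DEGREE `k` over `ℚ` of the eigenvalue of `e`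
on the `2`-form: `[ℚ(e|_T):ℚ] = k` divides `[E:ℚ]` and `[E:ℚ] · m = 22 - ρ(S)` with `m ≥ 3` (van Geemen),
so if `22 - ρ(S) ≠ k · j · m` for all `j ≥ 2`, `m ≥ 3` — e.g. whenever `6k > 22 - ρ(S)` — then
`E = ℚ[e|_T]` (abstract lemma `exists_eq_aeval_of_totallyReal_of_natDegree`, part 1 appended), unless
`E` is CM. This covers two of the three MAXIMAL van Geemen–Schütt types that the prime form misses:
`ℚ(ζ₉ + ζ₉⁻¹)` at `ρ = 10` (`k = 3`, `18 > 12`) and `ℚ(ζ₁₁ + ζ₁₁⁻¹)` at `ρ = 2` (`k = 5`, `30 > 20`);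
not `ℚ(√2)` at `ρ = 10` (`k = 2`: `12 = 2·2·3`, a quartic `E ⊋ ℚ(√2)` is not excluded by arithmetic).

* `generatedBy_or_hasComplexMultiplication_of_eigenvalue_natDegree` — for a projective K3 surface `S`, a
  rational type-preserving endomorphism `e` of `H²(S(ℂ); ℂ)` acting on a non-zero `(2,0)`-class by `ev`
  with `(minpoly ℚ ev).natDegree = k` and `k · j · m + ρ(S) ≠ 22` for all `j ≥ 2`, `m ≥ 3`:
  `TranscendentalEndomorphismsGeneratedBy S e ∨ HasComplexMultiplication S` (granted markings). Same
  marking picture as part 2, with `minpoly ℚ (e|_T) = minpoly ℚ ev` (`minpoly.algHom_eq` for the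
  `(2,0)`-eigenvalue embedding `ε` of Zarhin's theorem).

Consumers: `…OneCycleDegreeHodge` (HC⁴(S ⊗ S) from one such cycle-induced `e`). No definition, no sorry;
the named fact `Huybrechts_K3_marking_exists` only as hypothesis. Prover seat hodge-nonav-19652-p1
(gen 8), `--supports stmt-HodgeConjecture-19652`. Nothing here proves the crux or the Hodge conjecture.

References: van Geemen, Michigan Math. J. 56 (2008), Lemma 3.2; Zarhin, J. reine angew. Math. 341
(1983), Thm. 1.5.1; van Geemen–Schütt, Forum Math. Sigma 13 (2025) e2, Thm. 1.1 (9), (11), §2.1;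
Huybrechts, *Lectures on K3 Surfaces*, Ch. 3 Lemma 3.3.1, Thm. 3.3.7, (3.2).
-/
set_option linter.dupNamespace false

noncomputable section


namespace Summit.HodgeConjecture.HodgeConjecture.Theorems.MarkmanPartnerTransport.OneCycle

open scoped Manifold TensorProduct
open Module CategoryTheory MonoidalCategory CartesianMonoidalCategory Polynomial
open Literature.AlgebraicGeometry Literature.AlgebraicGeometry.Motives Literature.AlgebraicGeometry.HodgeTheory
open Literature.AlgebraicGeometry.Motives.HodgeStructure
open Literature.AlgebraicGeometry.Surfaces
open Literature.AlgebraicTopology.SingularHomology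
open Summit.HodgeConjecture.HodgeConjecture.Theorems
open Summit.HodgeConjecture.HodgeConjecture.Theorems.NikulinTwinTransport
open Summit.HodgeConjecture.HodgeConjecture.Theorems.AnchorExistenceCMFloor
open Summit.HodgeConjecture.HodgeConjecture.Theorems.MarkmanPartnerTransport.RealMultiplicationRanks

/-- The degree lemma `exists_eq_aeval_of_totallyReal_of_natDegree` with the degree read through an
injective `ℚ`-algebra map `ε : End_Hdg(V) → ℂ` (Zarhin's `(2,0)`-eigenvalue embedding):
`minpoly ℚ (ε r) = minpoly ℚ r` (`minpoly.algHom_eq`), so the hypothesis can be stated on the complex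
number `ε r` — which is how the K3 consumer below meets it. [cite: Vangeemen2008, Lemma 3.2] -/
theorem exists_eq_aeval_of_totallyReal_of_natDegree_algHom {V : Type*} [AddCommGroup V] [Module ℚ V]
    [Module.Finite ℚ V] {H : HodgeStructure V 2} (hirr : H.IsIrreducible) (hK3 : H.IsOfK3Type)
    (ψ : H.Polarization) (hF : IsField H.endAlg)
    (hreal : ∀ (φ : H.endAlg →+* ℂ) (a : H.endAlg), starRingEnd ℂ (φ a) = φ a)
    (ε : H.endAlg →ₐ[ℚ] ℂ) (hε : Function.Injective ε) {r : H.endAlg} {k : ℕ}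
    (hk : (minpoly ℚ (ε r)).natDegree = k)
    (hV : ∀ j m : ℕ, 2 ≤ j → 3 ≤ m → Module.finrank ℚ V ≠ k * j * m) (s : H.endAlg) :
    ∃ P : ℚ[X], s = aeval r P := by
  rw [minpoly.algHom_eq ε hε] at hk
  exact exists_eq_aeval_of_totallyReal_of_natDegree hirr hK3 ψ hF hreal hk hV s

variable {S : SchemeOver ℂ}

/-! ### One Hodge endomorphism with an eigenvalue of large degree generates `End_Hdg(T(S))` (or `S` is CM) -/

/-- **One endomorphism whose `(2,0)`-eigenvalue has degree `k`, with `k · j · m + ρ(S) ≠ 22` for all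
`j ≥ 2`, `m ≥ 3`, generates `End_Hdg(T(S))` (or `S` is CM).** Let `S` be a projective K3 surface and `e`
a `ℂ`-linear endomorphism of `H²(S(ℂ); ℂ)` preserving rational classes and Hodge types, acting on a
non-zero `(2,0)`-class by `ev` with `(minpoly ℚ ev).natDegree = k`. If `k · j · m + ρ(S) ≠ 22` whenever
`j ≥ 2`, `m ≥ 3` (e.g. `6k > 22 - ρ(S)`), then EITHER every rational Hodge endomorphism killing `N¹`
with image `⊥ N¹` is a rational polynomial in `e` on `T` (`TranscendentalEndomorphismsGeneratedBy S e`),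
OR `S` has complex multiplication. Marking picture of part 2; in `E = End_Hdg(T)` (a field, Zarhin) the
restriction `e|_T` has `ε(e|_T) = ev`, so `minpoly ℚ (e|_T) = minpoly ℚ ev` (`ε` injective); if `E` is
totally real, `exists_eq_aeval_of_totallyReal_of_natDegree` gives `E = ℚ[e|_T]`, read back on `H²(S)`;
otherwise Zarhin's adjoint theorem produces the CM endomorphism. [cite: Vangeemen2008, Lemma 3.2]
[cite: Zarhin1983HodgeGroupsK3, Thm. 1.5.1] [cite: Huybrechts2016K3, Ch. 3 Lemma 3.3.1 and Thm. 3.3.7] -/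
theorem generatedBy_or_hasComplexMultiplication_of_eigenvalue_natDegree
    (hmark : Huybrechts_K3_marking_exists) (hS : IsK3Surface S) {k : ℕ}
    (hk : ∀ j m : ℕ, 2 ≤ j → 3 ≤ m → k * j * m + Module.finrank ℂ ↥(algebraicClasses S 1) ≠ 22)
    (e : complexBetti S (2 * 1) →ₗ[ℂ] complexBetti S (2 * 1))
    (he_rat : ∀ y, IsRationalClass y → IsRationalClass (e y))
    (he_typ : ∀ (i j : ℕ) y, IsOfHodgeType 2 S (2 * 1) i j y → IsOfHodgeType 2 S (2 * 1) i j (e y))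
    (he_ev : ∃ (σ₀ : complexBetti S (2 * 1)) (ev : ℂ), IsOfHodgeType 2 S (2 * 1) 2 0 σ₀ ∧ σ₀ ≠ 0 ∧
      e σ₀ = ev • σ₀ ∧ (minpoly ℚ ev).natDegree = k) :
    TranscendentalEndomorphismsGeneratedBy S e ∨ HasComplexMultiplication S := by
  classical
  have hHT : Huybrechts_K3_hodgeTypes_H2 := Huybrechts_K3_hodgeTypes_H2_holds
  obtain ⟨η, p₀, x, hp₀, ⟨hp₀int, hp₀gen, hηint, hηcup, hx20, hx20'⟩, hxx, hxpos, hu⟩ := hmark S hS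
  set N := algebraicClasses S 1 with hNdef
  set σ := η.symm x with hσdef
  have hησ : η σ = x := by rw [hσdef, LinearEquiv.apply_symm_apply]
  have hxne : σ ≠ 0 := by
    intro h0
    have hx : x = 0 := by rw [← hησ, h0, map_zero]
    subst hx
    simp [k3Form] at hxpos
  have hxne' : x ≠ 0 := fun h => hxne (by rw [hσdef, h, map_zero])
  obtain ⟨h₁, -, h₃⟩ := hHT S hS σ hx20 hxne
  have hσbar : conjClass (ComplexPoints S) (2 * 1) σ = η.symm (star x) := conjClass_marking_symm η hηint x
  have hsmul0 : ∀ {c : ℂ}, c • p₀ = 0 → c = 0 := fun h => by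
    rcases smul_eq_zero.1 h with h | h
    · exact h
    · exact absurd h hp₀
  have hL11 : ∀ c : complexBetti S (2 * 1), IsRationalClass c → IsOfHodgeType 2 S (2 * 1) 1 1 c → c ∈ N :=
    fun c hc h11 => lefschetzOneOne_rational_holds hS.1 c hc h11
  have hND : ∀ c ∈ N, IsRationalClass c →
      (∀ d ∈ N, cupProduct (rfl : 2 * 1 + 2 * 1 = 2 * 2) c d = 0) → c = 0 :=
    fun c hcN hc hperp => anchorExistence_cmFloor_divisorClass_eq_zero_of_hodgeIndex
      hodgeIndex_surface_holds lefschetzOneOne_rational_holds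
      Grothendieck1969_supportedClasses_le_hodgeConiveau_holds hS hcN hc hperp
  -- the eigenvalue of `e` on `σ`
  obtain ⟨σ₀, ev, hσ₀20, hσ₀ne, heσ₀, hdeg⟩ := he_ev
  have heσ : e σ = ev • σ := by
    obtain ⟨t, ht⟩ := hx20' σ₀ hσ₀20
    have ht0 : t ≠ 0 := by
      rintro rfl
      rw [zero_smul] at ht
      exact hσ₀ne ht
    have h := heσ₀
    rw [ht, map_smul, smul_comm] at h
    exact smul_right_injective _ ht0 h
  -- rational classes are `Λ_ℚ`
  have hrat : ∀ c, IsRationalClass c ↔ ∃ w : K3Index → ℚ, η c = fun i => (w i : ℂ) :=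
    isRationalClass_iff_of_marking hS η hηint
  -- the rational points of `N`
  let NQ : Submodule ℚ (K3Index → ℚ) :=
    { carrier := {u | η.symm (fun j => (u j : ℂ)) ∈ N}
      add_mem' := fun {u v} hu hv => by
        simp only [Set.mem_setOf_eq, ratCastΛ_add, map_add]
        exact N.add_mem hu hv
      zero_mem' := by
        simp only [Set.mem_setOf_eq, ratCastΛ_zero, map_zero]
        exact N.zero_mem
      smul_mem' := fun q u hu => by
        simp only [Set.mem_setOf_eq, ratCastΛ_smul, map_smul]
        exact N.smul_mem _ hu }
  have memNQ : ∀ u, u ∈ NQ ↔ η.symm (fun j => (u j : ℂ)) ∈ N := fun u => Iff.rfl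
  -- `(1,1)`-classes through the marking
  have h11_iff : ∀ v : K3Index → ℂ, IsOfHodgeType 2 S (2 * 1) 1 1 (η.symm v) ↔
      (k3Form v x = 0 ∧ k3Form v (star x) = 0) := by
    intro v
    rw [h₃ (η.symm v), hηcup, hηcup, LinearEquiv.apply_symm_apply, hησ, hσbar, LinearEquiv.apply_symm_apply]
    constructor
    · rintro ⟨ha, hb⟩
      exact ⟨hsmul0 ha, hsmul0 hb⟩
    · rintro ⟨ha, hb⟩
      rw [ha, hb, zero_smul]
      exact ⟨rfl, rfl⟩
  -- `N_ℚ = Λ_ℚ ∩ {x, x̄}^⊥`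
  have hN : ∀ u : K3Index → ℚ, u ∈ NQ ↔
      (k3Form (fun i => (u i : ℂ)) x = 0 ∧ k3Form (fun i => (u i : ℂ)) (star x) = 0) := by
    intro u
    rw [memNQ, ← h11_iff]
    constructor
    · intro hu
      exact isOfHodgeType_of_mem_algebraicClasses_of_isSmoothProjective hS.1 1 hu
    · intro hu
      exact hL11 _ ((hrat _).2 ⟨u, LinearEquiv.apply_symm_apply _ _⟩) hu
  -- `N` is spanned by its rational classes, so `N_ℚ^⊥ ⊗ ℂ ⊥ N`
  have hspan := span_isRationalClass_eq_top_of_isSmoothProjective_holds.supportedClasses_eq_span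
    hS.1 (2 * 1) 1
  have horth : ∀ u ∈ k3FormRat.orthogonal NQ, ∀ d ∈ N, k3Form (fun j => (u j : ℂ)) (η d) = 0 := by
    intro u hu d hd
    rw [LinearMap.BilinForm.mem_orthogonal_iff] at hu
    have hd' : d ∈ Submodule.span ℂ {c : complexBetti S (2 * 1) |
        IsRationalClass c ∧ c ∈ supportedClasses S (2 * 1) 1} := by
      rw [← hspan]; exact hd
    clear hd
    induction hd' using Submodule.span_induction with
    | mem d hd =>
      obtain ⟨w, hw⟩ := (hrat d).1 hd.1
      have hwN : w ∈ NQ := by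
        rw [memNQ, ← hw, LinearEquiv.symm_apply_apply]
        exact hd.2
      rw [hw, k3Form_ratCast, k3FormRat_isSymm.eq, hu w hwN, Rat.cast_zero]
    | zero => rw [map_zero, k3Form_zero_right]
    | add c c' _ _ hc hc' => rw [map_add, k3Form_add_right, hc, hc', add_zero]
    | smul t c _ hc => rw [map_smul, k3Form_smul_right, hc, mul_zero]
  -- `N_ℚ ∩ N_ℚ^⊥ = 0` (Hodge index)
  have hdisj : Disjoint NQ (k3FormRat.orthogonal NQ) := by
    rw [Submodule.disjoint_def]
    intro u huN huT
    have hc0 : η.symm (fun j => (u j : ℂ)) = 0 :=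
      hND _ ((memNQ u).1 huN) ((hrat _).2 ⟨u, LinearEquiv.apply_symm_apply _ _⟩) fun d hd => by
        rw [hηcup, LinearEquiv.apply_symm_apply, horth u huT d hd, zero_smul]
    apply ratCastΛ_injective
    rw [ratCastΛ_zero]
    exact η.symm.injective (hc0.trans (map_zero _).symm)
  have hc := isCompl_orthogonal hdisj
  -- the transcendental Hodge structure, irreducible of K3 type, polarized; its endomorphism field
  set H := hodgeT hN hdisj hxx hxpos with hH
  have hK3 : H.IsOfK3Type := isOfK3Type_hodgeT hN hdisj hxx hxpos
  have hirr : H.IsIrreducible := isIrreducible_hodgeT hN hdisj hxx hxpos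
  set ψ : H.Polarization := polT hN hdisj hxx hxpos hu with hψ
  obtain ⟨hFld, ε, hεinj, hε⟩ := Zarhin1983_endAlg_isField_holds H hirr hK3
  have hω : omega x hdisj ∈ H.piece 2 0 := (mem_piece_two_zero_ofPeriod _ _).2 ⟨1, one_smul _ _⟩
  -- reading a rational type-preserving endomorphism of `H²(S)` in `E = End_Hdg(T)`
  have read : ∀ (G : complexBetti S (2 * 1) →ₗ[ℂ] complexBetti S (2 * 1)),
      (∀ y, IsRationalClass y → IsRationalClass (G y)) →
      (∀ (i j : ℕ) y, IsOfHodgeType 2 S (2 * 1) i j y → IsOfHodgeType 2 S (2 * 1) i j (G y)) →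
      ∃ (φ : Module.End ℚ (K3Index → ℚ)) (hφT : ∀ t ∈ k3FormRat.orthogonal NQ,
          φ t ∈ k3FormRat.orthogonal NQ),
        cxEnd φ = η.toLinearMap ∘ₗ G ∘ₗ η.symm.toLinearMap ∧ φ.restrict hφT ∈ H.endAlg := by
    intro G hG_rat hG_typ
    obtain ⟨φ, hφM, hφx, hφ11⟩ := anchorExistence_cmFloor_exists_ratEnd hHT hS η p₀ hp₀ hηint hηcup x hx20
      hx20' hxne G hG_rat hG_typ
    have hφT : ∀ t ∈ k3FormRat.orthogonal NQ, φ t ∈ k3FormRat.orthogonal NQ :=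
      fun t ht => map_mem_T hN φ hφx ht
    exact ⟨φ, hφT, hφM, restrict_mem_endAlg hN hdisj hxx hxpos φ hφT hφx hφ11⟩
  obtain ⟨φe, hφeT, hφeM, hre⟩ := read e he_rat he_typ
  have hφeMapp : ∀ v, cxEnd φe v = η (e (η.symm v)) := fun v => by rw [hφeM]; rfl
  have hcxpow : ∀ i : ℕ, cxEnd (φe ^ i) = cxEnd φe ^ i := fun i => map_pow cxEndHom φe i
  -- `ε(e|_T)` is the `(2,0)`-eigenvalue of `e`
  have hεre : ε ⟨φe.restrict hφeT, hre⟩ = ev := by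
    have h := hε ⟨φe.restrict hφeT, hre⟩ (omega x hdisj) hω
    have h2 := congrArg (iota (k3FormRat.orthogonal NQ)) h
    have hval : ((⟨φe.restrict hφeT, hre⟩ : H.endAlg) : Module.End ℚ ↥(k3FormRat.orthogonal NQ)) =
        φe.restrict hφeT := rfl
    rw [hval, iota_baseChange_restrict φe hφeT, iota_omega hN hdisj, map_smul, iota_omega hN hdisj,
      hφeMapp, ← hσdef, heσ, map_smul, hησ] at h2
    have h3 : (ev - ε ⟨φe.restrict hφeT, hre⟩) • x = 0 := by rw [sub_smul, h2, sub_self]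
    rcases smul_eq_zero.1 h3 with h4 | h4
    · exact (sub_eq_zero.1 h4).symm
    · exact absurd h4 hxne'
  -- so the `(2,0)`-eigenvalue `ε(e|_T) = ev` has minimal polynomial of degree `k`
  have hre_deg : (minpoly ℚ (ε ⟨φe.restrict hφeT, hre⟩)).natDegree = k := by rw [hεre, hdeg]
  -- `dim_ℚ N_ℚ = dim_ℂ N`, hence `dim_ℚ T = 22 - ρ(S)`
  let b := Module.finBasis ℚ NQ
  let c : Fin (Module.finrank ℚ ↥NQ) → complexBetti S (2 * 1) :=
    fun i => η.symm (fun j => (((b i : NQ) : K3Index → ℚ) j : ℂ))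
  have hcN : ∀ i, c i ∈ N := fun i => (memNQ _).1 (b i).2
  have hle : N ≤ Submodule.span ℂ (Set.range c) := by
    intro d hd
    have hd' : d ∈ Submodule.span ℂ {c : complexBetti S (2 * 1) |
        IsRationalClass c ∧ c ∈ supportedClasses S (2 * 1) 1} := by
      rw [← hspan]; exact hd
    refine Submodule.span_le.2 ?_ hd'
    rintro d ⟨hdQ, hdN⟩
    obtain ⟨w, hw⟩ := (hrat d).1 hdQ
    have hwN : w ∈ NQ := by
      rw [memNQ, ← hw, LinearEquiv.symm_apply_apply]
      exact hdN
    have hd_eq : d = η.symm (fun j => (w j : ℂ)) := by rw [← hw, LinearEquiv.symm_apply_apply]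
    have hw_eq : (w : K3Index → ℚ) = ∑ i, (b.repr ⟨w, hwN⟩ i) • ((b i : NQ) : K3Index → ℚ) := by
      have h := congrArg (fun t : NQ => (t : K3Index → ℚ)) (b.sum_repr ⟨w, hwN⟩).symm
      simpa only [Submodule.coe_sum, Submodule.coe_smul] using h
    rw [SetLike.mem_coe, hd_eq, hw_eq, ratCastΛ_sum, map_sum]
    refine Submodule.sum_mem _ fun i _ => ?_
    rw [ratCastΛ_smul, map_smul]
    exact Submodule.smul_mem _ _ (Submodule.subset_span ⟨i, rfl⟩)
  haveI : Module.Finite ℂ ↥(Submodule.span ℂ (Set.range c)) :=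
    Module.Finite.span_of_finite ℂ (Set.finite_range c)
  haveI : Module.Finite ℂ ↥N := Submodule.finiteDimensional_of_le hle
  have hdimN_le : Module.finrank ℂ ↥N ≤ Module.finrank ℚ ↥NQ :=
    (Submodule.finrank_mono hle).trans ((finrank_range_le_card c).trans (by simp))
  have hcind : LinearIndependent ℂ c := by
    rw [Fintype.linearIndependent_iff]
    intro z hz i
    have hB := (Algebra.TensorProduct.basis ℂ b).linearIndependent
    rw [Fintype.linearIndependent_iff] at hB
    refine hB z ?_ i
    apply iota_injective NQ
    rw [map_sum, map_zero]
    have h := congrArg η hz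
    rw [map_sum, map_zero] at h
    refine (Finset.sum_congr rfl fun j _ => ?_).trans h
    rw [map_smul, Algebra.TensorProduct.basis_apply, iota_one_tmul, map_smul, LinearEquiv.apply_symm_apply]
  have hdimN_ge : Module.finrank ℚ ↥NQ ≤ Module.finrank ℂ ↥N := by
    let c' : Fin (Module.finrank ℚ ↥NQ) → ↥N := fun i => ⟨c i, hcN i⟩
    have hcomp : ⇑N.subtype ∘ c' = c := funext fun i => rfl
    have hc' : LinearIndependent ℂ c' := LinearIndependent.of_comp N.subtype (hcomp ▸ hcind)
    simpa using hc'.fintype_card_le_finrank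
  have hdimN : Module.finrank ℚ ↥NQ = Module.finrank ℂ ↥N := le_antisymm hdimN_ge hdimN_le
  have hdimΛ : Module.finrank ℚ (K3Index → ℚ) = 22 := by
    rw [Module.finrank_fintype_fun_eq_card]
    simp [Fintype.card_sum, Fintype.card_fin]
  have hdimT : Module.finrank ℚ ↥(k3FormRat.orthogonal NQ) + Module.finrank ℂ ↥N = 22 := by
    have h := Submodule.finrank_add_eq_of_isCompl hc
    omega
  -- van Geemen + Zarhin: `E` totally real of prime degree, or a non-real embedding
  by_cases hreal : ∀ (φ' : H.endAlg →+* ℂ) (a : H.endAlg), starRingEnd ℂ (φ' a) = φ' a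
  · -- `E` totally real: `[E:ℚ]` is prime and `E = ℚ[e|_T]`
    left
    have hV : ∀ j m : ℕ, 2 ≤ j → 3 ≤ m → Module.finrank ℚ ↥(k3FormRat.orthogonal NQ) ≠ k * j * m :=
      fun j m hj hm h => hk j m hj hm (by rw [← h]; exact hdimT)
    intro f hf_rat hf_typ _ _
    obtain ⟨φf, hφfT, hφfM, hrf⟩ := read f hf_rat hf_typ
    have hφfMapp : ∀ v, cxEnd φf v = η (f (η.symm v)) := fun v => by rw [hφfM]; rfl
    obtain ⟨P, hP⟩ := exists_eq_aeval_of_totallyReal_of_natDegree_algHom hirr hK3 ψ hFld hreal ε hεinj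
      hre_deg hV ⟨φf.restrict hφfT, hrf⟩
    -- `φf = P(φe)` on `T`
    have hTeq : ∀ t ∈ k3FormRat.orthogonal NQ,
        φf t = ∑ i ∈ Finset.range (P.natDegree + 1), P.coeff i • (φe ^ i) t := by
      intro t ht
      have h1 : (φf.restrict hφfT : Module.End ℚ ↥(k3FormRat.orthogonal NQ)) =
          aeval (φe.restrict hφeT) P := by
        have h := congrArg Subtype.val hP
        rw [Polynomial.aeval_subalgebra_coe] at h
        exact h
      have h2 := congrArg Subtype.val (LinearMap.congr_fun h1 ⟨t, ht⟩)
      rw [LinearMap.coe_restrict_apply, Polynomial.aeval_eq_sum_range, LinearMap.sum_apply,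
        Submodule.coe_sum] at h2
      rw [h2]
      refine Finset.sum_congr rfl fun i _ => ?_
      rw [LinearMap.smul_apply, Submodule.coe_smul, Module.End.pow_restrict i hφeT,
        LinearMap.coe_restrict_apply]
    -- complexify: `cxEnd φf = Σ cᵢ (cxEnd φe)ⁱ` on `T_ℂ`
    have hpowη : ∀ (i : ℕ) (y : complexBetti S (2 * 1)), (cxEnd φe ^ i) (η y) = η ((e ^ i) y) := by
      intro i
      induction i with
      | zero => intro y; rw [pow_zero, pow_zero, Module.End.one_apply, Module.End.one_apply]
      | succ i ih =>
        intro y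
        rw [pow_succ', pow_succ', Module.End.mul_apply, Module.End.mul_apply, ih, hφeMapp,
          LinearEquiv.symm_apply_apply]
    have hcx : ∀ z : ℂ ⊗[ℚ] ↥(k3FormRat.orthogonal NQ),
        cxEnd φf (iota _ z) = ∑ i ∈ Finset.range (P.natDegree + 1),
          ((P.coeff i : ℚ) : ℂ) • (cxEnd φe ^ i) (iota _ z) := by
      intro z
      induction z using TensorProduct.induction_on with
      | zero => simp only [map_zero, smul_zero, Finset.sum_const_zero]
      | tmul a t =>
        rw [iota_tmul, map_smul, cxEnd_ratCast, hTeq _ t.2, ratCastΛ_sum, Finset.smul_sum]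
        refine Finset.sum_congr rfl fun i _ => ?_
        rw [ratCastΛ_smul, ← cxEnd_ratCast, hcxpow, map_smul, smul_comm]
      | add z₁ z₂ h₁ h₂ =>
        rw [map_add, map_add, h₁, h₂, ← Finset.sum_add_distrib]
        refine Finset.sum_congr rfl fun i _ => ?_
        rw [map_add, smul_add]
    refine ⟨P.natDegree + 1, fun i => P.coeff i, fun y hy => ?_⟩
    -- `η y ∈ T_ℂ`
    have hzN : ∀ n ∈ NQ, k3Form (η y) (fun i => (n i : ℂ)) = 0 := by
      intro n hn
      have h := hy _ ((memNQ n).1 hn)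
      rw [hηcup, LinearEquiv.apply_symm_apply] at h
      exact hsmul0 h
    have hz0 : cxEnd (NQ.projection _ hc) (η y) = 0 := cxEnd_projection_eq_zero hdisj hzN
    have hz : iota _ (lam hc (η y)) = η y := iota_lam_of_proj_eq_zero hc hz0
    have hfy : f y = η.symm (cxEnd φf (η y)) := by
      rw [hφfMapp, LinearEquiv.symm_apply_apply, LinearEquiv.symm_apply_apply]
    rw [hfy, ← hz, hcx, hz, map_sum, Finset.sum_range]
    refine Finset.sum_congr rfl fun i _ => ?_
    rw [map_smul, hpowη, LinearEquiv.symm_apply_apply]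
  · -- CM: an element of `End_Hdg(T)` with a non-real eigenvalue on `ω`, extended by `id_N`
    right
    push Not at hreal
    obtain ⟨φ', a, hφ'a⟩ := hreal
    obtain ⟨hadjex, hadjconj⟩ := Zarhin1983_adjoint_eq_conj_holds H hirr hK3 ψ
    obtain ⟨a', ha'⟩ := hadjex a
    have hne : a' ≠ a := by
      intro h
      apply hφ'a
      have key := hadjconj a a' ha' φ'
      rw [h] at key
      exact key.symm
    set μ : ℂ := ε a with hμdef
    have hμ : μ.im ≠ 0 := by
      intro him
      apply hne
      apply hεinj
      have key := hadjconj a a' ha' ε.toRingHom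
      change ε a' = starRingEnd ℂ (ε a) at key
      rw [key, ← hμdef]
      exact Complex.conj_eq_iff_im.2 him
    have hamem : ((a : H.endAlg) : Module.End ℚ ↥(k3FormRat.orthogonal NQ)) ∈ H.endAlg := a.2
    set û : Module.End ℚ (K3Index → ℚ) := extendT hdisj (a : Module.End ℚ ↥(k3FormRat.orthogonal NQ)) with hû
    have hûx : cxEnd û x = μ • x := by
      have h := hε a (omega x hdisj) hω
      have h2 := congrArg (iota (k3FormRat.orthogonal NQ)) h
      rw [iota_baseChange hdisj, iota_omega hN hdisj, map_smul, iota_omega hN hdisj] at h2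
      exact h2
    have hû11 : ∀ z : K3Index → ℂ, k3Form z x = 0 → k3Form z (star x) = 0 →
        k3Form (cxEnd û z) x = 0 ∧ k3Form (cxEnd û z) (star x) = 0 :=
      fun z hzx hzx' => k3Form_cxEnd_extendT hN hdisj hxx hxpos hamem hzx hzx'
    let Ψ : complexBetti S (2 * 1) →ₗ[ℂ] complexBetti S (2 * 1) :=
      η.symm.toLinearMap ∘ₗ cxEnd û ∘ₗ η.toLinearMap
    have hΨapp : ∀ y, Ψ y = η.symm (cxEnd û (η y)) := fun y => rfl
    have hΨrat : ∀ y, IsRationalClass y → IsRationalClass (Ψ y) := by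
      intro y hy
      obtain ⟨w, hw⟩ := (hrat y).1 hy
      rw [hΨapp, hw, cxEnd_ratCast]
      exact (hrat _).2 ⟨û w, LinearEquiv.apply_symm_apply _ _⟩
    have hΨσ : Ψ σ = μ • σ := by rw [hΨapp, hησ, hûx, map_smul]
    have hΨtyp : ∀ (i j : ℕ) y, IsOfHodgeType 2 S (2 * 1) i j y → IsOfHodgeType 2 S (2 * 1) i j (Ψ y) := by
      refine typePreserving_of_lines hHT hS hx20 hxne Ψ ⟨μ, hΨσ⟩ ⟨star μ, ?_⟩ fun v hv => ?_
      · rw [hσbar, hΨapp, LinearEquiv.apply_symm_apply, cxEnd_star, hûx, star_smul, map_smul]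
      · have hv' := hv
        rw [← LinearEquiv.symm_apply_apply η v, h11_iff] at hv'
        rw [hΨapp, h11_iff]
        exact hû11 (η v) hv'.1 hv'.2
    exact ⟨Ψ, hΨrat, hΨtyp, σ, μ, hx20, hxne, hμ, hΨσ⟩

end Summit.HodgeConjecture.HodgeConjecture.Theorems.MarkmanPartnerTransport.OneCycle

end
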